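import Literature.NumberTheory.ComplexMultiplication.CMTypeGaloisClassesInduced
import Literature.NumberTheory.ComplexMultiplication.SexticCMTypeGaloisClassesPairFlip
import Literature.NumberTheory.ComplexMultiplication.ReflexDegreeRankBounds
import HarnessLib

/-!
# All primitive CM types of a SEXTIC CM field are Galois equivalent (Dina–Ionica–Sijsling 2022, Cor. 13) — one
# uniform proof through reflex degrees; Props. 10–12 in Galois form: `2` Galois classes iff `K` contains an imaginary
# quadratic field (the imprimitive class `{ψ^K, ψ̄^K}` and ONE primitive class of `6` types of reflex degree `6`),
# `1` Galois class otherwise (all `8` types primitive, reflex degree `8`)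

Layer `Literature/NumberTheory/ComplexMultiplication`, namespace `Literature.NumberTheory.ComplexMultiplication` (lane
`lit-hodgefound`, Track 2 foundations, Layer A3; seat `lit-hodgefound-p11`, generation 25, row g25-#1).  Sequel of
`CMTypeGaloisEquivalence` (g24-#5: `cmTypeGaloisSetoid K`, DIS Def. 8; Prop. 10 for `C₆`), `CMTypeGaloisClassReflexDegree`
(g24-#6: the Galois class of `Φ` has `[ℚ(tr_Φ) : ℚ]` members), `CMTypeGaloisClassesSingle` (g24-#9: one class `⟺`
reflex degree `2^g`; consequences), `CMTypeGaloisClassesInduced` (g24-#10: the imprimitive class `{ψ^K, ψ̄^K}`),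
`SexticCMTypeGaloisClassesPairFlip` (g24-#11: Prop. 12 from `[Kᶜ : ℚ] ∈ {24, 48}`), `CMTypeEquivalenceClassesCount` §11
(the sextic subfield combinatorics: a proper subfield carrying a CM type is the unique imaginary quadratic subfield;
Streng-side counts `1 + 3` / `0 + 4`) and the tree's Ribet file `ReflexDegreeRankBounds` (`finrank_le_two_pow_of_isPrimitive`:
(3.2) `[K : ℚ] ≤ 2^{n*}` for a primitive type, Galois-side).  THEOREMS ONLY; no definition, no named fact (D-0026).

THE PRINT.  B. Dina, S. Ionica, J. Sijsling, *Isogenous hyperelliptic and non-hyperelliptic Jacobians with maximal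
complex multiplication*, Math. Comp. 91 (2022) (held text arXiv:2104.04919, p0007–p0008), §1.2:

> PROP. 10 «Let `K` be a sextic CM field with Galois group `C₆`. Then `K` admits `2` CM types up to equivalence,
> `1` of them primitive and `1` imprimitive. The same is true when replacing equivalence with Galois equivalence.»
> PROP. 11 «Let `K` be a sextic CM field with Galois group `D₆`. Then `K` admits `4` CM types up to equivalence, `3`
> of them primitive and `1` imprimitive. Up to Galois equivalence, `K` admits `2` CM types, `1` of them primitive and
> `1` imprimitive.» (proof: «`{0, 2, 4}` is induced by the unique quadratic CM subfield of `K` and is therefore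
> imprimitive, while the other types are primitive. Applying Galois equivalence allows us to multiply with `σ` …»)
> PROP. 12 «Let `K` be a sextic CM field with Galois group `C₂³ ⋊ C₃` or `C₂³ ⋊ S₃`. Then `K` admits `4` CM types up
> to equivalence, which are all primitive. Up to Galois equivalence, `K` admits `1` CM type.» (proof: «All of these
> types are primitive … because `K` has no proper quadratic subfields, let alone proper CM subfields.»)
> COR. 13 «Let `K` be a sextic CM field. Then all primitive CM types of `K` are Galois equivalent.» (proof: «We proved
> this result in Propositions 10, 11, and 12, which cover all individual cases in Theorem 3» — the four sextic Galois
> groups `C₆`, `D₆`, `C₂³ ⋊ C₃`, `C₂³ ⋊ S₃`.)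

K. Ribet, *Division fields of abelian varieties with complex multiplication* (1980), §3 (3.1)–(3.2) (p. 85):
«`[K : ℚ] = (G : H′) ≤ 2ᵈ`» and «by (3.1) and the symmetry we have `1 + Log d ≤ d′`» (`2d′ = [K* : ℚ]`, the type
primitive).  G. Shimura (1998) §8.3 Prop. 28: `[K* : ℚ] = [G : H*]`, `H* = {γ | γΦ = Φ}`.

THE UNIFORM ARGUMENT (replacing DIS's case split over the Galois group).  For a CM field `K` of degree `2g` the
Galois class of `Φ` has exactly `[K*_Φ : ℚ]` members (g24-#6), distinct classes are disjoint inside the `2^g` types, so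
two NON-equivalent types have `[K*_Φ : ℚ] + [K*_Ψ : ℚ] ≤ 2^g` (§1); and a PRIMITIVE type has `2g ≤ 2^{[K*_Φ : ℚ]/2}`
(Ribet (3.2), read in `ℂ`, §1).  For `g = 3`: a primitive type has `[K* : ℚ] ≥ 6`, and `6 + 6 > 8` — so any two
primitive types are Galois equivalent (Cor. 13, §2).  An imprimitive sextic type is induced from an imaginary quadratic
subfield `k₀` (the unique proper CM subfield), has `K* ≅ k₀`, reflex degree `2`, class `{Φ, Φ̄}` (g24-#10).  Hence: with
an imaginary quadratic subfield there are `2 + 6` types in exactly TWO classes and the primitive ones have reflex degree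
`6` (Props. 10–11, §3); without one, all `8` types are primitive and form ONE class of reflex degree `8 = 2³` (Prop. 12,
§4); a sextic CM field has `1` or `2` Galois classes, `2` iff it contains an imaginary quadratic field (§5).

WHAT IS PROVED.
* §1 (any CM field) **`finrank_le_two_pow_of_isPrimitive_complex`** (Ribet (3.2) in the complex model:
  `Φ` primitive ⟹ `[K : ℚ] ≤ 2^{[ℚ(tr_Φ) : ℚ]/2}`), **`two_dvd_finrank_traceField`** (`K*` is a CM field),
  **`finrank_traceField_add_le_two_pow_of_not_rel`** (non-equivalent types: `[K*_Φ : ℚ] + [K*_Ψ : ℚ] ≤ 2^g`),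
  `rel_of_two_pow_lt_add`.
* §2 (sextic) `six_le_finrank_traceField_of_isPrimitive`, `finrank_traceField_eq_six_or_eight_of_isPrimitive`,
  `finrank_traceField_eq_two_of_not_isPrimitive_of_finrank_eq_six`, `isPrimitive_iff_finrank_traceField_ne_two`;
  **`galoisRel_of_isPrimitive_of_finrank_eq_six` — DIS COR. 13 for every sextic CM field**, its Streng-primitive form
  `galoisRel_of_not_induced_of_finrank_eq_six`, and `card_cmTypeGaloisClasses_not_induced_le_one` (at most one
  primitive Galois class).
* §3 (sextic with an imaginary quadratic subfield `k₀`, i.e. `[k₀ : ℚ] = 2`, `k₀` totally complex — `C₆` and `D₆`):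
  **`card_cmTypeGaloisClasses_eq_two_of_quadratic`** («Up to Galois equivalence, `K` admits `2` CM types»),
  **`card_cmTypeGaloisClasses_induced_eq_one_of_quadratic` / `…_not_induced_eq_one_of_quadratic`** («`1` of them
  primitive and `1` imprimitive»), **`finrank_traceField_eq_six_of_isPrimitive_of_quadratic`** (primitive ⟹ reflex
  degree `6`, class of `6` members; imprimitive ⟹ `2`), and for `K` NOT normal (`D₆`) the full PROP. 11:
  **`dis_prop_eleven`** (`4 = 1 + 3` Streng classes, `2 = 1 + 1` Galois classes) with
  `cmTypeGaloisSetoid_ne_cmTypeEquivSetoid_of_quadratic` (Galois equivalence strictly coarser).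
* §4 (sextic with NO imaginary quadratic subfield carrying a CM type — `C₂³ ⋊ C₃`, `C₂³ ⋊ S₃`):
  **`card_cmTypeGaloisClasses_eq_one_of_no_quadratic`** (PROP. 12 «Up to Galois equivalence, `K` admits `1` CM type»,
  from «no proper CM subfield» alone), `isPrimitive_of_no_quadratic`, `finrank_traceField_eq_eight_of_no_quadratic`,
  `isNondegenerate_of_no_quadratic`, `SiegelCMPoint.IsCMPointOf.isSimple_of_no_quadratic`, `dis_prop_twelve`.
* §5 the dichotomy: **`card_cmTypeGaloisClasses_le_two_of_finrank_eq_six`**, `…_eq_one_or_eq_two…`,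
  **`card_cmTypeGaloisClasses_eq_two_iff_exists_quadratic`**, **`card_cmTypeGaloisClasses_eq_one_iff_forall_isPrimitive`**,
  and, with g24-#11, `isEmpty_cmType_quadratic_of_finrank_normalClosure` (`[Kᶜ : ℚ] ∈ {24, 48}` ⟹ no imaginary
  quadratic subfield).

## References

* [DinaIonicaSijsling2022] B. Dina, S. Ionica, J. Sijsling, Math. Comp. 91 (2022) (arXiv:2104.04919), §1.2 Def. 8,
  Props. 10, 11, 12, Cor. 13.
* [Ribet1980] K. A. Ribet, *Division fields of abelian varieties with complex multiplication*, Mém. SMF (2) 2 (1980),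
  §3 (3.1)–(3.2) (p. 85).
* [Shimura1998] G. Shimura, *Abelian Varieties with Complex Multiplication and Modular Functions* (1998), §8.2
  Prop. 26, §8.3 Prop. 28.
* [BCLLMNO2015] J. Balakrishnan, S. Ionica et al. (A. Bouw, J. Cooley, K. Lauter, E. Lorenzo García, M. Manes,
  R. Newton, E. Ozman), *Bad reduction of genus three curves with complex multiplication* (2015), §3.2, Cor. 3.4.
* [Dodson1984] B. Dodson, *The structure of Galois groups of CM-fields*, Trans. AMS 283 (1984), §1.3 Remark, §5.1.2–5.1.3.

## Provenance

Lane `lit-hodgefound` (HOME `run/shared/lean/pub/lit-hodgefound/`), prover seat `lit-hodgefound-p11` (gen 25),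
self-proposed row g25-#1 (INBOX claim 2026-08-27, l.40409).
-/

set_option autoImplicit false

noncomputable section

open scoped Classical NumberField Pointwise
open NumberField Module IntermediateField

namespace Literature.NumberTheory.ComplexMultiplication

open Literature.AlgebraicGeometry.Motives (CMType)
open Literature.AlgebraicGeometry.Motives.HodgeStructure (cmTypeSmul cmTypeSmul_val)
open Literature.AlgebraicGeometry (GaoUllmo2025.galoisClosure GaoUllmo2025.corestrict)

variable {K : Type} [Field K] [NumberField K] [IsCMField K]

/-! ## §1 Three facts valid for every CM field -/

section General

/-- **Ribet (3.2) in the complex model: a PRIMITIVE CM type satisfies `[K : ℚ] ≤ 2^{[K* : ℚ]/2}`**, `K* = ℚ(tr_Φ) ⊂ ℂ`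
(«by (3.1) and the symmetry we have `1 + Log d ≤ d′`»): the tree's Galois-side `finrank_le_two_pow_of_isPrimitive`
read in the Galois closure `K^c ⊂ ℂ` through the dictionaries `isPrimitive_algValuedIn_iff` (Shimura Prop. 26:
primitivity for `Aut(ℂ)` = primitivity for `Gal(K^c/ℚ)`) and `finrank_traceField_eq_finrank_reflexField`.
[cite: Ribet1980, §3 (3.1)–(3.2) (p. 85)] [cite: Shimura1998, §8.2 Prop. 26 and §8.3 Prop. 28] -/
theorem finrank_le_two_pow_of_isPrimitive_complex {Φ : CMType K} {φ₀ : K →+* ℂ}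
    (hprim : IsPrimitive (ℂ ≃+* ℂ) Φ.1 φ₀) : finrank ℚ K ≤ 2 ^ (finrank ℚ (traceField Φ) / 2) := by
  let Lc := GaoUllmo2025.galoisClosure K
  let j : K →ₐ[ℚ] Lc := GaoUllmo2025.corestrict K φ₀.toRatAlgHom
  let ι : Lc →+* ℂ := algebraMap Lc ℂ
  have hP : IsPrimitive (Lc ≃ₐ[ℚ] Lc) (algValuedIn ι Φ.1) j := (isPrimitive_algValuedIn_iff j ι Φ.1 j φ₀).2 hprim
  rw [finrank_traceField_eq_finrank_reflexField j ι Φ]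
  exact finrank_le_two_pow_of_isPrimitive j ι Φ hP

/-- **The reflex degree `[K* : ℚ]` is even** — `K* = ℚ(tr_Φ)` is a CM field (tree `isCMField_traceField`), a quadratic
extension of its maximal real subfield. [cite: Shimura1998, §8.3 Prop. 28] -/
theorem two_dvd_finrank_traceField (Φ : CMType K) : 2 ∣ finrank ℚ (traceField Φ) := by
  haveI : IsCMField (traceField Φ) := isCMField_traceField K Φ
  refine ⟨finrank ℚ (maximalRealSubfield (traceField Φ)), ?_⟩
  rw [← Module.finrank_mul_finrank ℚ (maximalRealSubfield (traceField Φ)) (traceField Φ),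
    Algebra.IsQuadraticExtension.finrank_eq_two (maximalRealSubfield (traceField Φ)) (traceField Φ), mul_comm]

/-- **Two CM types that are NOT Galois equivalent have `[K*_Φ : ℚ] + [K*_Ψ : ℚ] ≤ 2^g`**: their Galois classes, of
`[K*_Φ : ℚ]` and `[K*_Ψ : ℚ]` members (Shimura Prop. 28, g24-#6), are disjoint subsets of the `2^g` CM types.
[cite: Shimura1998, §8.3 Prop. 28] [cite: Ribet1980, §3 (3.1) (p. 85)] [cite: DinaIonicaSijsling2022, §1.2 Def. 8] -/
theorem finrank_traceField_add_le_two_pow_of_not_rel {Φ Ψ : CMType K} (h : ¬ (cmTypeGaloisSetoid K).r Φ Ψ) :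
    finrank ℚ (traceField Φ) + finrank ℚ (traceField Ψ) ≤ 2 ^ (finrank ℚ K / 2) := by
  haveI : Finite (CMType K) := finite_cmType
  rw [← natCard_galoisClass_eq_finrank_traceField Φ, ← natCard_galoisClass_eq_finrank_traceField Ψ,
    ← CMTypeCount.natCard_cmType (K := K), ← Nat.card_sum]
  refine Nat.card_le_card_of_injective (Sum.elim Subtype.val Subtype.val) ?_
  intro a b hxy
  rcases a with x | x <;> rcases b with y | y <;> simp only [Sum.elim_inl, Sum.elim_inr] at hxy
  · exact congrArg Sum.inl (Subtype.ext hxy)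
  · exfalso
    have hy : (cmTypeGaloisSetoid K).r Ψ x.1 := by rw [hxy]; exact y.2
    exact h ((cmTypeGaloisSetoid K).trans x.2 ((cmTypeGaloisSetoid K).symm hy))
  · exfalso
    have hx : (cmTypeGaloisSetoid K).r Φ x.1 := by rw [hxy]; exact y.2
    exact h ((cmTypeGaloisSetoid K).trans hx ((cmTypeGaloisSetoid K).symm x.2))
  · exact congrArg Sum.inr (Subtype.ext hxy)

/-- Contrapositive: types whose reflex degrees add up to more than `2^g` are Galois equivalent.
[cite: Shimura1998, §8.3 Prop. 28] [cite: DinaIonicaSijsling2022, §1.2 Def. 8] -/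
theorem rel_of_two_pow_lt_add {Φ Ψ : CMType K}
    (h : 2 ^ (finrank ℚ K / 2) < finrank ℚ (traceField Φ) + finrank ℚ (traceField Ψ)) :
    (cmTypeGaloisSetoid K).r Φ Ψ := by
  by_contra hn
  exact absurd (finrank_traceField_add_le_two_pow_of_not_rel hn) (not_le.2 h)

end General

/-! ## §2 Sextic CM fields: reflex degrees `2 | 6, 8`, and Cor. 13 -/

section Sextic

/-- **A PRIMITIVE type of a sextic CM field has reflex degree `≥ 6`** (`6 ≤ 2^{[K* : ℚ]/2}` forces `[K* : ℚ]/2 ≥ 3`).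
[cite: Ribet1980, §3 (3.2) (p. 85)] [cite: DinaIonicaSijsling2022, §1.2 Cor. 13] -/
theorem six_le_finrank_traceField_of_isPrimitive (h6 : finrank ℚ K = 6) {Φ : CMType K} {φ₀ : K →+* ℂ}
    (hprim : IsPrimitive (ℂ ≃+* ℂ) Φ.1 φ₀) : 6 ≤ finrank ℚ (traceField Φ) := by
  have h := finrank_le_two_pow_of_isPrimitive_complex hprim
  rw [h6] at h
  by_contra hlt
  have hle : finrank ℚ (traceField Φ) / 2 ≤ 2 := by omega
  have hpow : 2 ^ (finrank ℚ (traceField Φ) / 2) ≤ 2 ^ 2 := Nat.pow_le_pow_right two_pos hle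
  omega

/-- … hence reflex degree `6` or `8` (even, `≤ 2³`). [cite: Ribet1980, §3 (3.1)–(3.2) (p. 85)]
[cite: Shimura1998, §8.3 Prop. 28] -/
theorem finrank_traceField_eq_six_or_eight_of_isPrimitive (h6 : finrank ℚ K = 6) {Φ : CMType K} {φ₀ : K →+* ℂ}
    (hprim : IsPrimitive (ℂ ≃+* ℂ) Φ.1 φ₀) : finrank ℚ (traceField Φ) = 6 ∨ finrank ℚ (traceField Φ) = 8 := by
  have h1 := six_le_finrank_traceField_of_isPrimitive h6 hprim
  have h2 := finrank_traceField_le_two_pow Φ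
  rw [h6] at h2
  norm_num at h2
  obtain ⟨m, hm⟩ := two_dvd_finrank_traceField Φ
  omega

omit [IsCMField K] in
/-- **An IMPRIMITIVE type of a sextic CM field has reflex degree `2`**: it is induced from a proper subfield carrying a
CM type, which in degree `6` is imaginary quadratic (`finrank_eq_two_of_cmType_of_ne_top`), and `ℚ(tr_{Ψ^K}) = ℚ(tr_Ψ)`
has degree `2` (g24-#10). [cite: DinaIonicaSijsling2022, §1.2 Prop. 11 (proof)] [cite: BCLLMNO2015, §3 Cor. 3.4 (proof)]
[cite: Shimura1998, §8.2 Prop. 26] -/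
theorem finrank_traceField_eq_two_of_not_isPrimitive_of_finrank_eq_six (h6 : finrank ℚ K = 6) {Φ : CMType K} {φ₀ : K →+* ℂ}
    (h : ¬ IsPrimitive (ℂ ≃+* ℂ) Φ.1 φ₀) : finrank ℚ (traceField Φ) = 2 := by
  rw [← SiegelCMPoint.not_exists_inducedCMType_iff_isPrimitive Φ φ₀, not_not] at h
  obtain ⟨k, Θ, hk, rfl⟩ := h
  haveI : NumberField k := NumberField.mk
  rw [traceField_inducedCMType_ringHom, finrank_traceField_eq_two_of_finrank_eq_two
    (finrank_eq_two_of_cmType_of_ne_top h6 hk Θ)]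

/-- Sextic: `Φ` is primitive `⟺ [K*_Φ : ℚ] ≠ 2` (`⟺ [K*_Φ : ℚ] ≥ 6`). [cite: DinaIonicaSijsling2022, §1.2 Props. 11–12]
[cite: Shimura1998, §8.2 Prop. 26 and §8.3 Prop. 28] -/
theorem isPrimitive_iff_finrank_traceField_ne_two (h6 : finrank ℚ K = 6) (Φ : CMType K) (φ₀ : K →+* ℂ) :
    IsPrimitive (ℂ ≃+* ℂ) Φ.1 φ₀ ↔ finrank ℚ (traceField Φ) ≠ 2 := by
  constructor
  · intro h h2
    have := six_le_finrank_traceField_of_isPrimitive h6 h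
    omega
  · intro h
    by_contra hn
    exact h (finrank_traceField_eq_two_of_not_isPrimitive_of_finrank_eq_six h6 hn)

/-- Sextic: `Φ` is primitive `⟺ 6 ≤ [K*_Φ : ℚ]`. [cite: Ribet1980, §3 (3.2) (p. 85)] [cite: DinaIonicaSijsling2022, §1.2 Cor. 13] -/
theorem isPrimitive_iff_six_le_finrank_traceField (h6 : finrank ℚ K = 6) (Φ : CMType K) (φ₀ : K →+* ℂ) :
    IsPrimitive (ℂ ≃+* ℂ) Φ.1 φ₀ ↔ 6 ≤ finrank ℚ (traceField Φ) := by
  rw [isPrimitive_iff_finrank_traceField_ne_two h6 Φ φ₀]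
  constructor
  · intro h
    by_contra hlt
    have hprim : IsPrimitive (ℂ ≃+* ℂ) Φ.1 φ₀ := (isPrimitive_iff_finrank_traceField_ne_two h6 Φ φ₀).2 h
    exact hlt (six_le_finrank_traceField_of_isPrimitive h6 hprim)
  · intro h h2
    omega

/-- Primitivity of a sextic type does not depend on the base embedding (it is read off the reflex degree).
[cite: Shimura1998, §8.2 Prop. 26] -/
theorem isPrimitive_iff_isPrimitive_of_finrank_eq_six (h6 : finrank ℚ K = 6) (Φ : CMType K) (φ₀ φ₁ : K →+* ℂ) :
    IsPrimitive (ℂ ≃+* ℂ) Φ.1 φ₀ ↔ IsPrimitive (ℂ ≃+* ℂ) Φ.1 φ₁ := by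
  rw [isPrimitive_iff_finrank_traceField_ne_two h6 Φ φ₀, isPrimitive_iff_finrank_traceField_ne_two h6 Φ φ₁]

/-- **DIS COR. 13 «Let `K` be a sextic CM field. Then all primitive CM types of `K` are Galois equivalent»** — for
EVERY sextic CM field, with no case distinction on `Gal(Kᶜ/ℚ)`: two primitive types have reflex degrees `≥ 6` each,
and `6 + 6 > 2³`, so their Galois classes cannot be disjoint. [cite: DinaIonicaSijsling2022, §1.2 Cor. 13]
[cite: Ribet1980, §3 (3.1)–(3.2) (p. 85)] [cite: Shimura1998, §8.3 Prop. 28] -/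
theorem galoisRel_of_isPrimitive_of_finrank_eq_six (h6 : finrank ℚ K = 6) {Φ Ψ : CMType K} {φ₀ φ₁ : K →+* ℂ}
    (hΦ : IsPrimitive (ℂ ≃+* ℂ) Φ.1 φ₀) (hΨ : IsPrimitive (ℂ ≃+* ℂ) Ψ.1 φ₁) : (cmTypeGaloisSetoid K).r Φ Ψ := by
  refine rel_of_two_pow_lt_add ?_
  have h1 := six_le_finrank_traceField_of_isPrimitive h6 hΦ
  have h2 := six_le_finrank_traceField_of_isPrimitive h6 hΨ
  rw [h6]
  norm_num
  omega

/-- Cor. 13 with Streng's primitivity «not induced from a CM type of a strict CM subfield».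
[cite: DinaIonicaSijsling2022, §1.2 Cor. 13] [cite: Shimura1998, §8.2 Prop. 26] -/
theorem galoisRel_of_not_induced_of_finrank_eq_six (h6 : finrank ℚ K = 6) {Φ Ψ : CMType K}
    (hΦ : ¬ ∃ (k : IntermediateField ℚ K) (Θ : CMType k), k ≠ ⊤ ∧ inducedCMType (algebraMap k K) Θ = Φ)
    (hΨ : ¬ ∃ (k : IntermediateField ℚ K) (Θ : CMType k), k ≠ ⊤ ∧ inducedCMType (algebraMap k K) Θ = Ψ) :
    (cmTypeGaloisSetoid K).r Φ Ψ := by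
  obtain ⟨φ₀⟩ := (inferInstance : Nonempty (K →+* ℂ))
  exact galoisRel_of_isPrimitive_of_finrank_eq_six h6
    ((SiegelCMPoint.not_exists_inducedCMType_iff_isPrimitive Φ φ₀).1 hΦ)
    ((SiegelCMPoint.not_exists_inducedCMType_iff_isPrimitive Ψ φ₀).1 hΨ)

/-- Cor. 13, class form: `⟦Φ⟧ = ⟦Ψ⟧` for primitive `Φ, Ψ`. [cite: DinaIonicaSijsling2022, §1.2 Cor. 13] -/
theorem cmTypeGaloisClass_eq_of_isPrimitive_of_finrank_eq_six (h6 : finrank ℚ K = 6) {Φ Ψ : CMType K}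
    {φ₀ φ₁ : K →+* ℂ} (hΦ : IsPrimitive (ℂ ≃+* ℂ) Φ.1 φ₀) (hΨ : IsPrimitive (ℂ ≃+* ℂ) Ψ.1 φ₁) :
    Quotient.mk (cmTypeGaloisSetoid K) Φ = Quotient.mk (cmTypeGaloisSetoid K) Ψ :=
  Quotient.sound (galoisRel_of_isPrimitive_of_finrank_eq_six h6 hΦ hΨ)

/-- The Galois class of a primitive sextic type consists of primitive types (a type Galois equivalent to an induced
one is induced, g24-#10). [cite: DinaIonicaSijsling2022, §1.2 Prop. 10 (proof: «the Galois equivalence does not affect primitivity»)] -/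
theorem not_induced_of_rel_of_not_induced {Φ Θ : CMType K}
    (hΦ : ¬ ∃ (k : IntermediateField ℚ K) (Ψ : CMType k), k ≠ ⊤ ∧ inducedCMType (algebraMap k K) Ψ = Φ)
    (h : (cmTypeGaloisSetoid K).r Φ Θ) :
    ¬ ∃ (k : IntermediateField ℚ K) (Ψ : CMType k), k ≠ ⊤ ∧ inducedCMType (algebraMap k K) Ψ = Θ := by
  rintro ⟨k, Ψ, hk, rfl⟩
  obtain ⟨Ψ', hΨ'⟩ := exists_inducedCMType_eq_of_rel k ⟨Ψ, rfl⟩ ((cmTypeGaloisSetoid K).symm h)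
  exact hΦ ⟨k, Ψ', hk, hΨ'⟩

/-- **Sextic: there is AT MOST ONE Galois class of primitive types.** [cite: DinaIonicaSijsling2022, §1.2 Cor. 13] -/
theorem card_cmTypeGaloisClasses_not_induced_le_one (h6 : finrank ℚ K = 6) :
    Nat.card {q : Quotient (cmTypeGaloisSetoid K) // ∀ Φ : CMType K, Quotient.mk _ Φ = q →
        ¬ ∃ (k : IntermediateField ℚ K) (Ψ : CMType k), k ≠ ⊤ ∧ inducedCMType (algebraMap k K) Ψ = Φ} ≤ 1 := by
  haveI := finite_cmTypeGaloisClasses (K := K)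
  refine Finite.card_le_one_iff_subsingleton.2 ⟨fun q q' => Subtype.ext ?_⟩
  obtain ⟨q, hq⟩ := q
  obtain ⟨q', hq'⟩ := q'
  obtain ⟨Φ, rfl⟩ := Quotient.exists_rep q
  obtain ⟨Φ', rfl⟩ := Quotient.exists_rep q'
  exact Quotient.sound (galoisRel_of_not_induced_of_finrank_eq_six h6 (hq Φ rfl) (hq' Φ' rfl))

end Sextic

/-! ## §3 Sextic CM field WITH an imaginary quadratic subfield `k₀` (`C₆`, `D₆`): exactly two Galois classes -/

section Quadratic

variable (k₀ : IntermediateField ℚ K)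

omit [IsCMField K] in
/-- The family «induced from a strict subfield» is the family «induced from `k₀`» (tree
`exists_inducedCMType_iff_of_finrank_eq_six`: `k₀` is the unique proper subfield carrying a CM type). [cite: BCLLMNO2015, §3.2]
[cite: DinaIonicaSijsling2022, §1.2 Prop. 11] -/
theorem isPrimitive_iff_not_exists_inducedCMType_quadratic (h6 : finrank ℚ K = 6) (hk₀ : finrank ℚ k₀ = 2)
    (Φ : CMType K) (φ₀ : K →+* ℂ) :
    IsPrimitive (ℂ ≃+* ℂ) Φ.1 φ₀ ↔ ¬ ∃ Ψ₀ : CMType k₀, inducedCMType (algebraMap k₀ K) Ψ₀ = Φ := by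
  rw [← SiegelCMPoint.not_exists_inducedCMType_iff_isPrimitive Φ φ₀, exists_inducedCMType_iff_of_finrank_eq_six h6 k₀ hk₀]

variable [IsTotallyComplex k₀]

omit [IsCMField K] in
/-- A CM type `Ψ₀` of `k₀` exists (`k₀` is totally complex). [cite: Shimura1998, §8.2] -/
private theorem exists_cmType_quadratic : Nonempty (CMType k₀) :=
  CMTypeCount.nonempty_cmType_iff_isTotallyComplex.2 inferInstance

omit [IsTotallyComplex k₀] in
/-- The class of an induced type `Ψ₀^K` differs from the class of a type not induced from `k₀`. [cite: DinaIonicaSijsling2022, §1.2 Prop. 11] -/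
private theorem cmTypeGaloisClass_ne_of_induced_of_not (Ψ₀ : CMType k₀) {Φ : CMType K}
    (hΦ : ¬ ∃ Ψ : CMType k₀, inducedCMType (algebraMap k₀ K) Ψ = Φ) :
    Quotient.mk (cmTypeGaloisSetoid K) (inducedCMType (algebraMap k₀ K) Ψ₀) ≠ Quotient.mk (cmTypeGaloisSetoid K) Φ :=
  fun h => hΦ (exists_inducedCMType_eq_of_rel k₀ ⟨Ψ₀, rfl⟩ (Quotient.exact h))

/-- **DIS PROPS. 10–11 IN GALOIS FORM, uniformly: a sextic CM field with an imaginary quadratic subfield has EXACTLY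
TWO Galois classes of CM types** («Up to Galois equivalence, `K` admits `2` CM types») — the class `{ψ^K, ψ̄^K}` of the
two types induced from `k₀` (g24-#10) and the class of the six primitive types (Cor. 13).  No hypothesis on the Galois
group: `C₆` (Prop. 10, also g24-#5 §4) and `D₆` (Prop. 11) alike. [cite: DinaIonicaSijsling2022, §1.2 Props. 10–11]
[cite: Shimura1998, §8.3 Prop. 28] -/
theorem card_cmTypeGaloisClasses_eq_two_of_quadratic (h6 : finrank ℚ K = 6) (hk₀ : finrank ℚ k₀ = 2) :
    Nat.card (Quotient (cmTypeGaloisSetoid K)) = 2 := by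
  haveI := finite_cmTypeGaloisClasses (K := K)
  obtain ⟨Ψ₀⟩ := exists_cmType_quadratic k₀
  -- a type `Φ₁` not induced from `k₀` (there are `6` of them)
  have hpos : 0 < Nat.card {Φ : CMType K //
      ¬ ∃ (k : IntermediateField ℚ K) (Ψ : CMType k), k ≠ ⊤ ∧ inducedCMType (algebraMap k K) Ψ = Φ} := by
    rw [natCard_not_induced_eq_six_of_finrank_eq_six_of_quadratic h6 k₀ hk₀]; norm_num
  obtain ⟨⟨Φ₁, hΦ₁⟩⟩ := Nat.card_pos_iff.1 hpos |>.1
  have hΦ₁' : ¬ ∃ Ψ : CMType k₀, inducedCMType (algebraMap k₀ K) Ψ = Φ₁ := by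
    rwa [← exists_inducedCMType_iff_of_finrank_eq_six h6 k₀ hk₀ Φ₁]
  rw [Nat.card_eq_two_iff]
  refine ⟨Quotient.mk _ (inducedCMType (algebraMap k₀ K) Ψ₀), Quotient.mk _ Φ₁,
    cmTypeGaloisClass_ne_of_induced_of_not k₀ Ψ₀ hΦ₁', Set.eq_univ_of_forall fun q => ?_⟩
  obtain ⟨Θ, rfl⟩ := Quotient.exists_rep q
  simp only [Set.mem_insert_iff, Set.mem_singleton_iff]
  by_cases hΘ : ∃ Ψ : CMType k₀, inducedCMType (algebraMap k₀ K) Ψ = Θ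
  · -- both classes lie in the one-element family of classes of types induced from `k₀`
    left
    haveI := (Nat.card_eq_one_iff_unique.1 (card_cmTypeGaloisClasses_induced_eq_one k₀ hk₀ Ψ₀)).1
    have hmemΘ : ∀ Φ : CMType K, Quotient.mk (cmTypeGaloisSetoid K) Φ = Quotient.mk _ Θ →
        ∃ Ψ : CMType k₀, inducedCMType (algebraMap k₀ K) Ψ = Φ := fun Φ h =>
      exists_inducedCMType_eq_of_rel k₀ hΘ (Quotient.exact h.symm)
    have hmem₀ : ∀ Φ : CMType K, Quotient.mk (cmTypeGaloisSetoid K) Φ =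
        Quotient.mk _ (inducedCMType (algebraMap k₀ K) Ψ₀) → ∃ Ψ : CMType k₀, inducedCMType (algebraMap k₀ K) Ψ = Φ :=
      fun Φ h => exists_inducedCMType_eq_of_rel k₀ ⟨Ψ₀, rfl⟩ (Quotient.exact h.symm)
    exact Subtype.ext_iff.1 (Subsingleton.elim (⟨Quotient.mk _ Θ, hmemΘ⟩ : {q : Quotient (cmTypeGaloisSetoid K) //
      ∀ Φ : CMType K, Quotient.mk _ Φ = q → ∃ Ψ : CMType k₀, inducedCMType (algebraMap k₀ K) Ψ = Φ})
      ⟨Quotient.mk _ (inducedCMType (algebraMap k₀ K) Ψ₀), hmem₀⟩)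
  · right
    have hΘ' : ¬ ∃ (k : IntermediateField ℚ K) (Ψ : CMType k), k ≠ ⊤ ∧ inducedCMType (algebraMap k K) Ψ = Θ := by
      rwa [exists_inducedCMType_iff_of_finrank_eq_six h6 k₀ hk₀ Θ]
    exact Quotient.sound (galoisRel_of_not_induced_of_finrank_eq_six h6 hΘ' hΦ₁)

/-- **«… `1` of them imprimitive»**: the imprimitive types (induced from SOME strict CM subfield — necessarily `k₀`) form
exactly ONE Galois class, `{ψ^K, ψ̄^K}` (g24-#10 transported along `exists_inducedCMType_iff_of_finrank_eq_six`).
[cite: DinaIonicaSijsling2022, §1.2 Props. 10–11] [cite: BCLLMNO2015, §3.2] -/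
theorem card_cmTypeGaloisClasses_induced_eq_one_of_quadratic (h6 : finrank ℚ K = 6) (hk₀ : finrank ℚ k₀ = 2) :
    Nat.card {q : Quotient (cmTypeGaloisSetoid K) // ∀ Φ : CMType K, Quotient.mk _ Φ = q →
        ∃ (k : IntermediateField ℚ K) (Ψ : CMType k), k ≠ ⊤ ∧ inducedCMType (algebraMap k K) Ψ = Φ} = 1 := by
  obtain ⟨Ψ₀⟩ := exists_cmType_quadratic k₀
  rw [← card_cmTypeGaloisClasses_induced_eq_one k₀ hk₀ Ψ₀]
  refine Nat.card_congr (Equiv.subtypeEquivRight fun q => forall_congr' fun Φ => forall_congr' fun _ => ?_)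
  exact exists_inducedCMType_iff_of_finrank_eq_six h6 k₀ hk₀ Φ

/-- **«… `1` of them primitive»**: the six primitive types form exactly ONE Galois class.
[cite: DinaIonicaSijsling2022, §1.2 Props. 10–11 and Cor. 13] -/
theorem card_cmTypeGaloisClasses_not_induced_eq_one_of_quadratic (h6 : finrank ℚ K = 6) (hk₀ : finrank ℚ k₀ = 2) :
    Nat.card {q : Quotient (cmTypeGaloisSetoid K) // ∀ Φ : CMType K, Quotient.mk _ Φ = q →
        ¬ ∃ (k : IntermediateField ℚ K) (Ψ : CMType k), k ≠ ⊤ ∧ inducedCMType (algebraMap k K) Ψ = Φ} = 1 := by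
  haveI := finite_cmTypeGaloisClasses (K := K)
  refine le_antisymm (card_cmTypeGaloisClasses_not_induced_le_one h6) ?_
  have hpos : 0 < Nat.card {Φ : CMType K //
      ¬ ∃ (k : IntermediateField ℚ K) (Ψ : CMType k), k ≠ ⊤ ∧ inducedCMType (algebraMap k K) Ψ = Φ} := by
    rw [natCard_not_induced_eq_six_of_finrank_eq_six_of_quadratic h6 k₀ hk₀]; norm_num
  obtain ⟨⟨Φ₁, hΦ₁⟩⟩ := Nat.card_pos_iff.1 hpos |>.1
  exact Nat.card_pos_iff.2 ⟨⟨⟨Quotient.mk _ Φ₁, fun Θ h => not_induced_of_rel_of_not_induced hΦ₁ (Quotient.exact h.symm)⟩⟩,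
    inferInstance⟩

/-- With an imaginary quadratic subfield: **a PRIMITIVE type has reflex degree EXACTLY `6`** (not `8`: reflex degree
`2³` would make a single Galois class, g24-#9). [cite: DinaIonicaSijsling2022, §1.2 Props. 10–11] [cite: Shimura1998, §8.3 Prop. 28]
[cite: Dodson1984, §1.3 Remark and §5.1.3] -/
theorem finrank_traceField_eq_six_of_isPrimitive_of_quadratic (h6 : finrank ℚ K = 6) (hk₀ : finrank ℚ k₀ = 2)
    {Φ : CMType K} {φ₀ : K →+* ℂ} (hprim : IsPrimitive (ℂ ≃+* ℂ) Φ.1 φ₀) : finrank ℚ (traceField Φ) = 6 := by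
  rcases finrank_traceField_eq_six_or_eight_of_isPrimitive h6 hprim with h | h
  · exact h
  · exfalso
    have h1 := card_cmTypeGaloisClasses_eq_one_iff_exists.2 ⟨Φ, by rw [h, h6]; norm_num⟩
    have h2 := card_cmTypeGaloisClasses_eq_two_of_quadratic k₀ h6 hk₀
    omega

/-- … so its Galois class has exactly `6` members (all the primitive types). [cite: DinaIonicaSijsling2022, §1.2 Props. 10–11]
[cite: Shimura1998, §8.3 Prop. 28] -/
theorem natCard_galoisClass_eq_six_of_isPrimitive_of_quadratic (h6 : finrank ℚ K = 6) (hk₀ : finrank ℚ k₀ = 2)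
    {Φ : CMType K} {φ₀ : K →+* ℂ} (hprim : IsPrimitive (ℂ ≃+* ℂ) Φ.1 φ₀) :
    Nat.card {Ψ : CMType K // ∃ τ : ℂ ≃+* ℂ, Ψ = cmTypeSmul τ Φ} = 6 := by
  rw [natCard_galoisClass_eq_finrank_traceField, finrank_traceField_eq_six_of_isPrimitive_of_quadratic k₀ h6 hk₀ hprim]

/-- With an imaginary quadratic subfield: the reflex degree of a type is `2` (imprimitive) or `6` (primitive).
[cite: DinaIonicaSijsling2022, §1.2 Props. 10–11] [cite: Shimura1998, §8.3 Prop. 28] -/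
theorem finrank_traceField_eq_two_or_six_of_quadratic (h6 : finrank ℚ K = 6) (hk₀ : finrank ℚ k₀ = 2) (Φ : CMType K) :
    finrank ℚ (traceField Φ) = 2 ∨ finrank ℚ (traceField Φ) = 6 := by
  obtain ⟨φ₀⟩ := (inferInstance : Nonempty (K →+* ℂ))
  by_cases h : IsPrimitive (ℂ ≃+* ℂ) Φ.1 φ₀
  · exact Or.inr (finrank_traceField_eq_six_of_isPrimitive_of_quadratic k₀ h6 hk₀ h)
  · exact Or.inl (finrank_traceField_eq_two_of_not_isPrimitive_of_finrank_eq_six h6 h)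

/-- A type NOT induced from `k₀` has reflex degree `6`. [cite: DinaIonicaSijsling2022, §1.2 Props. 10–11] -/
theorem finrank_traceField_eq_six_of_not_induced_of_quadratic (h6 : finrank ℚ K = 6) (hk₀ : finrank ℚ k₀ = 2)
    {Φ : CMType K} (hΦ : ¬ ∃ Ψ₀ : CMType k₀, inducedCMType (algebraMap k₀ K) Ψ₀ = Φ) :
    finrank ℚ (traceField Φ) = 6 := by
  obtain ⟨φ₀⟩ := (inferInstance : Nonempty (K →+* ℂ))
  exact finrank_traceField_eq_six_of_isPrimitive_of_quadratic k₀ h6 hk₀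
    ((isPrimitive_iff_not_exists_inducedCMType_quadratic k₀ h6 hk₀ Φ φ₀).2 hΦ)

omit [IsCMField K] [IsTotallyComplex k₀] in
/-- A type induced from `k₀` has reflex degree `2` (`K* = ψ(k₀)`). [cite: DinaIonicaSijsling2022, §1.3 Prop. 16 («the reflex CM type of an imprimitive CM type … is the restriction … to the quadratic CM subfield»)]
[cite: Streng2010, Ch. I Lemma 3.4 (1)] -/
theorem finrank_traceField_inducedCMType_quadratic (hk₀ : finrank ℚ k₀ = 2) (Ψ₀ : CMType k₀) :
    finrank ℚ (traceField (inducedCMType (algebraMap k₀ K) Ψ₀)) = 2 := by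
  haveI : NumberField k₀ := NumberField.mk
  rw [traceField_inducedCMType_ringHom, finrank_traceField_eq_two_of_finrank_eq_two hk₀]

/-- With an imaginary quadratic subfield no type has the maximal reflex degree `8`. [cite: Dodson1984, §1.3 and §5.1.3]
[cite: DinaIonicaSijsling2022, §1.2 Props. 10–11] -/
theorem finrank_traceField_lt_eight_of_quadratic (h6 : finrank ℚ K = 6) (hk₀ : finrank ℚ k₀ = 2) (Φ : CMType K) :
    finrank ℚ (traceField Φ) < 8 := by
  rcases finrank_traceField_eq_two_or_six_of_quadratic k₀ h6 hk₀ Φ with h | h <;> omega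

/-- **DIS PROP. 11 (the `D₆` case: `K` NOT normal with an imaginary quadratic subfield), assembled**: `4` classes up to
equivalence, `1` imprimitive and `3` primitive (tree, g24-#2 §11), but `2` classes up to Galois equivalence, `1 + 1`.
[cite: DinaIonicaSijsling2022, §1.2 Prop. 11] -/
theorem dis_prop_eleven (h6 : finrank ℚ K = 6) (hK : ¬ IsGalois ℚ K) (hk₀ : finrank ℚ k₀ = 2) :
    Nat.card (Quotient (cmTypeEquivSetoid K)) = 4 ∧
    Nat.card {q : Quotient (cmTypeEquivSetoid K) // ∀ Φ : CMType K, Quotient.mk _ Φ = q →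
        ∃ (k : IntermediateField ℚ K) (Ψ : CMType k), k ≠ ⊤ ∧ inducedCMType (algebraMap k K) Ψ = Φ} = 1 ∧
    Nat.card {q : Quotient (cmTypeEquivSetoid K) // ∀ Φ : CMType K, Quotient.mk _ Φ = q →
        ¬ ∃ (k : IntermediateField ℚ K) (Ψ : CMType k), k ≠ ⊤ ∧ inducedCMType (algebraMap k K) Ψ = Φ} = 3 ∧
    Nat.card (Quotient (cmTypeGaloisSetoid K)) = 2 ∧
    Nat.card {q : Quotient (cmTypeGaloisSetoid K) // ∀ Φ : CMType K, Quotient.mk _ Φ = q →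
        ∃ (k : IntermediateField ℚ K) (Ψ : CMType k), k ≠ ⊤ ∧ inducedCMType (algebraMap k K) Ψ = Φ} = 1 ∧
    Nat.card {q : Quotient (cmTypeGaloisSetoid K) // ∀ Φ : CMType K, Quotient.mk _ Φ = q →
        ¬ ∃ (k : IntermediateField ℚ K) (Ψ : CMType k), k ≠ ⊤ ∧ inducedCMType (algebraMap k K) Ψ = Φ} = 1 :=
  ⟨card_classes_eq_four_of_finrank_eq_six_of_not_isGalois h6 hK,
    card_classes_induced_eq_one_of_finrank_eq_six_of_not_isGalois h6 hK k₀ hk₀,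
    card_classes_not_induced_eq_three_of_finrank_eq_six_of_not_isGalois h6 hK k₀ hk₀,
    card_cmTypeGaloisClasses_eq_two_of_quadratic k₀ h6 hk₀,
    card_cmTypeGaloisClasses_induced_eq_one_of_quadratic k₀ h6 hk₀,
    card_cmTypeGaloisClasses_not_induced_eq_one_of_quadratic k₀ h6 hk₀⟩

/-- `D₆`: Galois equivalence is STRICTLY coarser than equivalence (`2 ≠ 4` classes). [cite: DinaIonicaSijsling2022, §1.2 Prop. 11] -/
theorem cmTypeGaloisSetoid_ne_cmTypeEquivSetoid_of_quadratic (h6 : finrank ℚ K = 6) (hK : ¬ IsGalois ℚ K)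
    (hk₀ : finrank ℚ k₀ = 2) : cmTypeGaloisSetoid K ≠ cmTypeEquivSetoid K := by
  intro heq
  have h2 := card_cmTypeGaloisClasses_eq_two_of_quadratic k₀ h6 hk₀
  rw [heq, card_classes_eq_four_of_finrank_eq_six_of_not_isGalois h6 hK] at h2
  exact absurd h2 (by norm_num)

/-- `D₆`: there are primitive types `Φ, Ψ` which are Galois equivalent but NOT equivalent (three Streng classes inside
the one primitive Galois class). [cite: DinaIonicaSijsling2022, §1.2 Prop. 11] -/
theorem exists_galoisRel_not_rel_of_quadratic (h6 : finrank ℚ K = 6) (hK : ¬ IsGalois ℚ K) (hk₀ : finrank ℚ k₀ = 2) :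
    ∃ Φ Ψ : CMType K, (cmTypeGaloisSetoid K).r Φ Ψ ∧ ¬ (cmTypeEquivSetoid K).r Φ Ψ := by
  by_contra hall
  push Not at hall
  apply cmTypeGaloisSetoid_ne_cmTypeEquivSetoid_of_quadratic k₀ h6 hK hk₀
  refine Setoid.ext fun Φ Ψ => ⟨hall Φ Ψ, fun hr => ?_⟩
  obtain ⟨σ, rfl⟩ := hr
  rcases (equiv_iff_eq_or_eq_bar_of_finrank_eq_six_of_not_isGalois h6 hK Φ _).1 ⟨σ, rfl⟩ with he | he
  · simpa only [he] using (cmTypeGaloisSetoid K).refl Φ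
  · simpa only [he] using cmTypeGaloisSetoid_r_bar Φ

end Quadratic

/-! ## §4 Sextic CM field WITHOUT an imaginary quadratic subfield (`C₂³ ⋊ C₃`, `C₂³ ⋊ S₃`): one Galois class -/

section NoQuadratic

omit [IsCMField K] in
/-- «`K` has no proper quadratic subfields, let alone proper CM subfields» ⟹ every CM type is primitive (complex form of
the tree's `not_exists_inducedCMType_of_finrank_eq_six_of_no_quadratic`). [cite: DinaIonicaSijsling2022, §1.2 Prop. 12 (proof)]
[cite: BCLLMNO2015, §3 Cor. 3.4] -/
theorem isPrimitive_of_no_quadratic (h6 : finrank ℚ K = 6)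
    (hno : ∀ k : IntermediateField ℚ K, finrank ℚ k = 2 → IsEmpty (CMType k)) (Φ : CMType K) (φ₀ : K →+* ℂ) :
    IsPrimitive (ℂ ≃+* ℂ) Φ.1 φ₀ :=
  (SiegelCMPoint.not_exists_inducedCMType_iff_isPrimitive Φ φ₀).1
    (not_exists_inducedCMType_of_finrank_eq_six_of_no_quadratic h6 hno Φ)

/-- **DIS PROP. 12 IN GALOIS FORM «Up to Galois equivalence, `K` admits `1` CM type» — from «no proper CM subfield»
alone** (all types primitive, Cor. 13).  (g24-#11 derived it from `[Kᶜ : ℚ] ∈ {24, 48}`.) [cite: DinaIonicaSijsling2022, §1.2 Prop. 12]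
[cite: BCLLMNO2015, §3 Cor. 3.4] -/
theorem card_cmTypeGaloisClasses_eq_one_of_no_quadratic (h6 : finrank ℚ K = 6)
    (hno : ∀ k : IntermediateField ℚ K, finrank ℚ k = 2 → IsEmpty (CMType k)) :
    Nat.card (Quotient (cmTypeGaloisSetoid K)) = 1 := by
  obtain ⟨φ₀⟩ := (inferInstance : Nonempty (K →+* ℂ))
  exact card_cmTypeGaloisClasses_eq_one_iff.2 fun Φ Ψ =>
    galoisRel_of_isPrimitive_of_finrank_eq_six h6 (isPrimitive_of_no_quadratic h6 hno Φ φ₀)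
      (isPrimitive_of_no_quadratic h6 hno Ψ φ₀)

/-- … any two CM types are Galois equivalent. [cite: DinaIonicaSijsling2022, §1.2 Prop. 12] -/
theorem galoisRel_of_no_quadratic (h6 : finrank ℚ K = 6)
    (hno : ∀ k : IntermediateField ℚ K, finrank ℚ k = 2 → IsEmpty (CMType k)) (Φ Ψ : CMType K) :
    (cmTypeGaloisSetoid K).r Φ Ψ :=
  card_cmTypeGaloisClasses_eq_one_iff.1 (card_cmTypeGaloisClasses_eq_one_of_no_quadratic h6 hno) Φ Ψ

/-- … every type has the maximal reflex degree `[K* : ℚ] = 8 = 2³`. [cite: DinaIonicaSijsling2022, §1.2 Prop. 12]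
[cite: Dodson1984, §5.1.3 Proposition 1] [cite: Shimura1998, §8.3 Prop. 28] -/
theorem finrank_traceField_eq_eight_of_no_quadratic (h6 : finrank ℚ K = 6)
    (hno : ∀ k : IntermediateField ℚ K, finrank ℚ k = 2 → IsEmpty (CMType k)) (Φ : CMType K) :
    finrank ℚ (traceField Φ) = 8 := by
  have h := card_cmTypeGaloisClasses_eq_one_iff_forall.1 (card_cmTypeGaloisClasses_eq_one_of_no_quadratic h6 hno) Φ
  rw [h6] at h
  exact h

/-- … every type is nondegenerate (Ribet Cor. 3.6 via g24-#9). [cite: Ribet1980, §3 Cor. (3.6)] [cite: Dodson1984, §5.1.3 Proposition 1] -/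
theorem isNondegenerate_of_no_quadratic (h6 : finrank ℚ K = 6)
    (hno : ∀ k : IntermediateField ℚ K, finrank ℚ k = 2 → IsEmpty (CMType k)) (Φ : CMType K) :
    Literature.AlgebraicGeometry.Pohlmann1968.IsNondegenerate Φ :=
  isNondegenerate_of_card_cmTypeGaloisClasses_eq_one (card_cmTypeGaloisClasses_eq_one_of_no_quadratic h6 hno) Φ

open Literature.NumberTheory.Automorphic (siegelUpperHalfSpace)
open Literature.AlgebraicGeometry.ModuliOfAbelianVarieties.SiegelModuli (prinPeriod)
open Literature.Geometry.Kaehler.ComplexTorus (IsIsogenous IsSimple)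

/-- … every CM point of `K` on `𝔥₃` has a simple torus. [cite: Shimura1998, §8.2 Prop. 26] [cite: DinaIonicaSijsling2022, §1.2 Prop. 12] -/
theorem SiegelCMPoint.IsCMPointOf.isSimple_of_no_quadratic (h6 : finrank ℚ K = 6)
    (hno : ∀ k : IntermediateField ℚ K, finrank ℚ k = 2 → IsEmpty (CMType k)) {Z : siegelUpperHalfSpace 3}
    {h : K →ₐ[ℚ] Matrix (Fin 3 ⊕ Fin 3) (Fin 3 ⊕ Fin 3) ℚ} (hZ : SiegelCMPoint.IsCMPointOf h Z) :
    IsSimple (prinPeriod Z) :=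
  hZ.isSimple_of_card_cmTypeGaloisClasses_eq_one (h6.trans (by norm_num))
    (card_cmTypeGaloisClasses_eq_one_of_no_quadratic h6 hno)

/-- **DIS PROP. 12 assembled** (`K` not normal, no imaginary quadratic subfield carrying a CM type): «`4` CM types up to
equivalence, which are all primitive. Up to Galois equivalence, `K` admits `1` CM type.» [cite: DinaIonicaSijsling2022, §1.2 Prop. 12] -/
theorem dis_prop_twelve (h6 : finrank ℚ K = 6) (hK : ¬ IsGalois ℚ K)
    (hno : ∀ k : IntermediateField ℚ K, finrank ℚ k = 2 → IsEmpty (CMType k)) :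
    Nat.card (Quotient (cmTypeEquivSetoid K)) = 4 ∧
    Nat.card {q : Quotient (cmTypeEquivSetoid K) // ∀ Φ : CMType K, Quotient.mk _ Φ = q →
        ¬ ∃ (k : IntermediateField ℚ K) (Ψ : CMType k), k ≠ ⊤ ∧ inducedCMType (algebraMap k K) Ψ = Φ} = 4 ∧
    Nat.card (Quotient (cmTypeGaloisSetoid K)) = 1 :=
  ⟨card_classes_eq_four_of_finrank_eq_six_of_not_isGalois h6 hK,
    card_classes_not_induced_eq_four_of_finrank_eq_six_of_no_quadratic h6 hK hno,
    card_cmTypeGaloisClasses_eq_one_of_no_quadratic h6 hno⟩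

end NoQuadratic

/-! ## §5 The sextic dichotomy: `1` or `2` Galois classes, `2` iff an imaginary quadratic subfield -/

section Dichotomy

omit [IsCMField K] in
/-- A quadratic intermediate field carrying a CM type is totally complex. [cite: Shimura1998, §8.2] -/
private theorem isTotallyComplex_of_nonempty {k : IntermediateField ℚ K} (h : Nonempty (CMType k)) : IsTotallyComplex k :=
  CMTypeCount.nonempty_cmType_iff_isTotallyComplex.1 h

/-- **A sextic CM field has exactly TWO Galois classes iff it contains an imaginary quadratic field** (a quadratic
subfield carrying a CM type). [cite: DinaIonicaSijsling2022, §1.2 Props. 10–12] -/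
theorem card_cmTypeGaloisClasses_eq_two_iff_exists_quadratic (h6 : finrank ℚ K = 6) :
    Nat.card (Quotient (cmTypeGaloisSetoid K)) = 2 ↔
      ∃ k : IntermediateField ℚ K, finrank ℚ k = 2 ∧ Nonempty (CMType k) := by
  constructor
  · intro h2
    by_contra hno
    push Not at hno
    have h1 := card_cmTypeGaloisClasses_eq_one_of_no_quadratic h6 hno
    omega
  · rintro ⟨k₀, hk₀, hne⟩
    haveI := isTotallyComplex_of_nonempty hne
    exact card_cmTypeGaloisClasses_eq_two_of_quadratic k₀ h6 hk₀

/-- **… and exactly ONE Galois class iff it contains none.** [cite: DinaIonicaSijsling2022, §1.2 Props. 10–12] -/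
theorem card_cmTypeGaloisClasses_eq_one_iff_no_quadratic (h6 : finrank ℚ K = 6) :
    Nat.card (Quotient (cmTypeGaloisSetoid K)) = 1 ↔
      ∀ k : IntermediateField ℚ K, finrank ℚ k = 2 → IsEmpty (CMType k) := by
  constructor
  · intro h1 k hk
    by_contra hne
    rw [not_isEmpty_iff] at hne
    haveI := isTotallyComplex_of_nonempty hne
    have h2 := card_cmTypeGaloisClasses_eq_two_of_quadratic k h6 hk
    omega
  · exact card_cmTypeGaloisClasses_eq_one_of_no_quadratic h6

/-- **The sextic dichotomy: a sextic CM field has `1` or `2` Galois classes of CM types** (never the `4` that equivalence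
allows). [cite: DinaIonicaSijsling2022, §1.2 Props. 10–12 and Cor. 13] -/
theorem card_cmTypeGaloisClasses_eq_one_or_eq_two_of_finrank_eq_six (h6 : finrank ℚ K = 6) :
    Nat.card (Quotient (cmTypeGaloisSetoid K)) = 1 ∨ Nat.card (Quotient (cmTypeGaloisSetoid K)) = 2 := by
  by_cases h : ∃ k : IntermediateField ℚ K, finrank ℚ k = 2 ∧ Nonempty (CMType k)
  · exact Or.inr ((card_cmTypeGaloisClasses_eq_two_iff_exists_quadratic h6).2 h)
  · push Not at h
    exact Or.inl (card_cmTypeGaloisClasses_eq_one_of_no_quadratic h6 h)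

/-- A sextic CM field has at most two Galois classes of CM types. [cite: DinaIonicaSijsling2022, §1.2 Props. 10–12] -/
theorem card_cmTypeGaloisClasses_le_two_of_finrank_eq_six (h6 : finrank ℚ K = 6) :
    Nat.card (Quotient (cmTypeGaloisSetoid K)) ≤ 2 := by
  rcases card_cmTypeGaloisClasses_eq_one_or_eq_two_of_finrank_eq_six h6 with h | h <;> omega

/-- **One Galois class `⟺` every CM type is primitive** (sextic). [cite: DinaIonicaSijsling2022, §1.2 Prop. 12 and Cor. 13]
[cite: Shimura1998, §8.2 Prop. 26] -/
theorem card_cmTypeGaloisClasses_eq_one_iff_forall_isPrimitive (h6 : finrank ℚ K = 6) (φ₀ : K →+* ℂ) :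
    Nat.card (Quotient (cmTypeGaloisSetoid K)) = 1 ↔ ∀ Φ : CMType K, IsPrimitive (ℂ ≃+* ℂ) Φ.1 φ₀ :=
  ⟨fun h1 Φ => isPrimitive_of_card_cmTypeGaloisClasses_eq_one h1 Φ φ₀,
    fun h => card_cmTypeGaloisClasses_eq_one_iff.2 fun Φ Ψ => galoisRel_of_isPrimitive_of_finrank_eq_six h6 (h Φ) (h Ψ)⟩

/-- **Two Galois classes `⟺` some CM type is imprimitive** (sextic). [cite: DinaIonicaSijsling2022, §1.2 Props. 10–11] -/
theorem card_cmTypeGaloisClasses_eq_two_iff_exists_not_isPrimitive (h6 : finrank ℚ K = 6) (φ₀ : K →+* ℂ) :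
    Nat.card (Quotient (cmTypeGaloisSetoid K)) = 2 ↔ ∃ Φ : CMType K, ¬ IsPrimitive (ℂ ≃+* ℂ) Φ.1 φ₀ := by
  rw [← not_forall, ← card_cmTypeGaloisClasses_eq_one_iff_forall_isPrimitive h6 φ₀]
  rcases card_cmTypeGaloisClasses_eq_one_or_eq_two_of_finrank_eq_six h6 with h | h <;> omega

/-- The reflex degree of a sextic CM type is `2`, `6` or `8`; `8` occurs iff there is one Galois class.
[cite: Dodson1984, §1.3 Reflex Degree Theorem and §5.1.2–5.1.3] [cite: DinaIonicaSijsling2022, §1.2 Props. 10–12] -/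
theorem finrank_traceField_mem_of_finrank_eq_six (h6 : finrank ℚ K = 6) (Φ : CMType K) :
    finrank ℚ (traceField Φ) = 2 ∨ finrank ℚ (traceField Φ) = 6 ∨ finrank ℚ (traceField Φ) = 8 := by
  obtain ⟨φ₀⟩ := (inferInstance : Nonempty (K →+* ℂ))
  by_cases h : IsPrimitive (ℂ ≃+* ℂ) Φ.1 φ₀
  · exact Or.inr (finrank_traceField_eq_six_or_eight_of_isPrimitive h6 h)
  · exact Or.inl (finrank_traceField_eq_two_of_not_isPrimitive_of_finrank_eq_six h6 h)

/-- Reflex degree `8` for SOME type `⟺` ONE Galois class `⟺` no imaginary quadratic subfield. [cite: Dodson1984, §1.3 and §5.1.3]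
[cite: DinaIonicaSijsling2022, §1.2 Prop. 12] -/
theorem exists_finrank_traceField_eq_eight_iff_no_quadratic (h6 : finrank ℚ K = 6) :
    (∃ Φ : CMType K, finrank ℚ (traceField Φ) = 8) ↔
      ∀ k : IntermediateField ℚ K, finrank ℚ k = 2 → IsEmpty (CMType k) := by
  rw [← card_cmTypeGaloisClasses_eq_one_iff_no_quadratic h6, card_cmTypeGaloisClasses_eq_one_iff_exists, h6]
  norm_num

variable {L : Type} [Field L] [NumberField L] [IsCMField L] [IsNormalClosure ℚ K L]

/-- With g24-#11: **a sextic CM field whose Galois closure has degree `24` or `48` (`C₂³ ⋊ C₃`, `C₂³ ⋊ S₃`) contains NO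
imaginary quadratic field** — one Galois class there, two here. [cite: Dodson1984, §5.1.2 Theorem and §5.1.3 Proposition 1]
[cite: DinaIonicaSijsling2022, §1.2 Props. 11–12] -/
theorem isEmpty_cmType_quadratic_of_finrank_normalClosure (h6 : finrank ℚ K = 6)
    (hL : finrank ℚ L = 24 ∨ finrank ℚ L = 48) (k : IntermediateField ℚ K) (hk : finrank ℚ k = 2) :
    IsEmpty (CMType k) :=
  (card_cmTypeGaloisClasses_eq_one_iff_no_quadratic h6).1 (card_cmTypeGaloisClasses_eq_one_of_sextic (L := L) h6 hL) k hk

/-- Contrapositive: an imaginary quadratic subfield forces `[Kᶜ : ℚ] ∉ {24, 48}` (Dodson: the closure is then `ℤ₂ × ℤ₃`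
or `ℤ₂ × 𝔖₃`, of order `6` or `12`). [cite: Dodson1984, §5.1.2 Theorem] [cite: DinaIonicaSijsling2022, §1.2 Props. 10–11] -/
theorem finrank_normalClosure_ne_of_quadratic (h6 : finrank ℚ K = 6) (k₀ : IntermediateField ℚ K)
    (hk₀ : finrank ℚ k₀ = 2) [IsTotallyComplex k₀] : finrank ℚ L ≠ 24 ∧ finrank ℚ L ≠ 48 := by
  obtain ⟨Ψ₀⟩ : Nonempty (CMType k₀) := CMTypeCount.nonempty_cmType_iff_isTotallyComplex.2 inferInstance
  constructor
  · intro h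
    exact (isEmpty_cmType_quadratic_of_finrank_normalClosure (L := L) h6 (Or.inl h) k₀ hk₀).false Ψ₀
  · intro h
    exact (isEmpty_cmType_quadratic_of_finrank_normalClosure (L := L) h6 (Or.inr h) k₀ hk₀).false Ψ₀

end Dichotomy

end Literature.NumberTheory.ComplexMultiplication
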